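import Mathlib

/-!
# SoloBlindGaloisFloor — regularity of transversal block systems (the Galois floor of the `e = 1` door)

Solo residency `solo-HodgeConjecture-blind`, session s43 (gen 44); informal companion: `work/s43/galois-floor.md`
(LEMMA SPAN, PROPOSITION NP, THEOREM GF).

Setting (informal). Let `π₀ : C₁ × C₂ ⇢ X` be a dominant rational map of degree `d` from a product of smooth curves onto a
K3 surface `X`, `ω := π₀^* σ_X ∈ H⁰(K_{C₁}) ⊗ H⁰(K_{C₂})` of tensor rank `r`, and `Λ¹_x := p_{1*} π^*[x] ∈ |L₁|` (degree `d`)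
the Abel presentation, `n₁ := dim |L₁|`.

* LEMMA SPAN. The fibre identity `Σᵢ λᵢ · u_{pᵢ} ⊗ v_{qᵢ} = H(·, ω)` (sum over a general fibre `{(pᵢ, qᵢ)}`, `u_p`, `v_q` the
  canonical images) shows that the row space of `ω` (dimension `r`) lies in the span of the `u_{pᵢ}`; in matrix form this is
  `rank (U * D * Vᵀ) ≤ rank U` (`rank_fibre_form_le`). With Riemann–Roch it gives the squeeze `n₁ ≤ d - r`.
* THEOREM GF. If both presentations are pencils (`f_j : C_j → ℙ¹` of degree `d`), then over a general point of `ℙ¹ × ℙ¹`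
  the grid `Λ_s × Λ_t ≅ [d] × [d]` is partitioned into the `d` fibres of `π₀`, each the graph of a bijection `σ`, and the
  monodromy group `G₁ × G₂` of `f₁ × f₂` permutes these blocks, `(g, 1) · graph σ = graph (σ ∘ g⁻¹)`. The combinatorial heart,
  formalised here as `regular_of_transversal_design`, is: a finite set `S` of permutations of `Fin d` covering every pair
  `(i, j)` exactly once and closed under right multiplication by a transitive subgroup `G` forces `|G| = d` with all point
  stabilisers trivial. Hence `f₁`, `f₂` are Galois, `π₀` is the quotient by a factor-preserving group of order `d`, and
  THEOREM PQ(b) of the residency gives `rank T(X) ≤ 4`.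
* Arithmetic consequences on the `T₈` face (`r` a positive multiple of `8`, no pencils: `2 ≤ n`): degree `9` is impossible,
  degree `10` forces complete nets (`n = 2 = d - r`, so `g = r = 8` by the rigidity clause of SPAN), and for type-I carriers
  (`3 ≤ n ≤ d - 17`) at least `20` letters are needed.

Everything here is elementary and sorry-free; the geometric inputs (Abel's theorem, the trace/pull-back adjunction, the Galois
correspondence for function fields, PQ(b)) are recorded in the companion notes, not formalised.
-/

namespace Summit.HodgeConjecture.HodgeConjecture.Theorems.GaloisFloor

open Equiv

/-- In a transversal design `S ⊆ Perm (Fin d)` (every pair `(i, j)` is covered by exactly one member), reading off the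
image of any fixed point `i` is a bijection `S → Fin d`; in particular `S.card = d`. -/
theorem card_eq_of_transversal {d : ℕ} (S : Finset (Perm (Fin d)))
    (hS : ∀ i j : Fin d, ∃! σ, σ ∈ S ∧ σ i = j) (i : Fin d) : S.card = d := by
  classical
  have hbij : Function.Bijective (fun σ : S => (σ : Perm (Fin d)) i) := by
    constructor
    · rintro ⟨σ, hσ⟩ ⟨τ, hτ⟩ h
      have h' : σ i = τ i := by simpa using h
      exact Subtype.ext ((hS i (σ i)).unique ⟨hσ, rfl⟩ ⟨hτ, h'.symm⟩)
    · intro j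
      obtain ⟨σ, ⟨hσ, hσj⟩, -⟩ := hS i j
      exact ⟨⟨σ, hσ⟩, hσj⟩
  have h := Fintype.card_of_bijective hbij
  simpa [Fintype.card_coe, Fintype.card_fin] using h

/-- **Regularity of transversal block systems** (the Galois floor). Let `G ≤ Perm (Fin d)` be transitive and let
`S ⊆ Perm (Fin d)` be a transversal design (every pair `(i, j)` covered by exactly one `σ ∈ S`) that is closed under right
multiplication by `G`. Then `|G| = d` and every element of `G` with a fixed point is the identity (all point stabilisers are
trivial, i.e. `G` acts regularly). Geometric reading: the monodromy group of each pencil `f_j : C_j → ℙ¹` of a two-pencil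
product domination `C₁ × C₂ ⇢ X` is regular, so `f_j` is a Galois cover. -/
theorem regular_of_transversal_design {d : ℕ} (G : Subgroup (Perm (Fin d)))
    (htrans : ∀ i j : Fin d, ∃ g ∈ G, g i = j)
    (S : Finset (Perm (Fin d)))
    (hS : ∀ i j : Fin d, ∃! σ, σ ∈ S ∧ σ i = j)
    (hclosed : ∀ σ ∈ S, ∀ g ∈ G, σ * g ∈ S) (i₀ : Fin d) :
    Nat.card G = d ∧ ∀ g ∈ G, (∃ i, g i = i) → g = 1 := by
  classical
  have hcardS : S.card = d := card_eq_of_transversal S hS i₀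
  obtain ⟨σ₀, ⟨hσ₀, -⟩, -⟩ := hS i₀ i₀
  -- `G` embeds into `S` by `g ↦ σ₀ * g`, so `|G| ≤ |S| = d`.
  have hle : Fintype.card G ≤ d := by
    have hinj : Function.Injective (fun g : G => (⟨σ₀ * g, hclosed σ₀ hσ₀ g g.2⟩ : S)) := by
      rintro ⟨g, hg⟩ ⟨h, hh⟩ hgh
      have : σ₀ * g = σ₀ * h := by simpa using hgh
      exact Subtype.ext (mul_left_cancel this)
    have h := Fintype.card_le_of_injective _ hinj
    simpa [Fintype.card_coe, hcardS] using h
  -- transitivity: `g ↦ g i` is onto `Fin d` for every `i`, so `d ≤ |G|`.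
  have hsurj : ∀ i : Fin d, Function.Surjective (fun g : G => (g : Perm (Fin d)) i) := by
    intro i j
    obtain ⟨g, hg, hgi⟩ := htrans i j
    exact ⟨⟨g, hg⟩, hgi⟩
  have hge : d ≤ Fintype.card G := by
    have h := Fintype.card_le_of_surjective _ (hsurj i₀)
    simpa [Fintype.card_fin] using h
  have hcardF : Fintype.card G = d := le_antisymm hle hge
  have hcard : Nat.card G = d := by rw [Nat.card_eq_fintype_card, hcardF]
  refine ⟨hcard, ?_⟩
  rintro g hg ⟨i, hgi⟩
  -- a surjection between finite types of equal cardinality is a bijection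
  have hbij : Function.Bijective (fun g : G => (g : Perm (Fin d)) i) :=
    (hsurj i).bijective_of_nat_card_le (by rw [hcard, Nat.card_eq_fintype_card, Fintype.card_fin])
  have h1 : (fun g : G => (g : Perm (Fin d)) i) ⟨g, hg⟩ = (fun g : G => (g : Perm (Fin d)) i) 1 := by
    simpa using hgi
  have h2 := hbij.1 h1
  simpa using congrArg Subtype.val h2

/-- Under the hypotheses of `regular_of_transversal_design` the design is a single right coset of `G`: every member of
`S` is `σ₀ * g` for the chosen `σ₀ ∈ S` and a unique `g ∈ G`. (So the block system is the one cut out by the quotient map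
`C₁ × C₂ → (C₁ × C₂)/H`, `H = {(g, σ₀ g σ₀⁻¹)}`.) -/
theorem design_eq_coset {d : ℕ} (G : Subgroup (Perm (Fin d)))
    (htrans : ∀ i j : Fin d, ∃ g ∈ G, g i = j)
    (S : Finset (Perm (Fin d)))
    (hS : ∀ i j : Fin d, ∃! σ, σ ∈ S ∧ σ i = j)
    (hclosed : ∀ σ ∈ S, ∀ g ∈ G, σ * g ∈ S) {σ₀ : Perm (Fin d)} (hσ₀ : σ₀ ∈ S) :
    ∀ σ ∈ S, ∃ g ∈ G, σ = σ₀ * g := by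
  classical
  intro σ hσ
  rcases Nat.eq_zero_or_pos d with hd | hd
  · subst hd
    refine ⟨1, G.one_mem, ?_⟩
    ext i; exact i.elim0
  · set i₀ : Fin d := ⟨0, hd⟩
    have hreg := regular_of_transversal_design G htrans S hS hclosed i₀
    have hcardS : S.card = d := card_eq_of_transversal S hS i₀
    -- the injection `g ↦ σ₀ * g : G → S` is a bijection since both sides have `d` elements
    have hinj : Function.Injective (fun g : G => (⟨σ₀ * g, hclosed σ₀ hσ₀ g g.2⟩ : S)) := by
      rintro ⟨g, hg⟩ ⟨h, hh⟩ hgh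
      have : σ₀ * g = σ₀ * h := by simpa using hgh
      exact Subtype.ext (mul_left_cancel this)
    have hbij := hinj.bijective_of_nat_card_le
      (by rw [hreg.1, Nat.card_eq_fintype_card, Fintype.card_coe, hcardS])
    obtain ⟨⟨g, hg⟩, hgσ⟩ := hbij.2 ⟨σ, hσ⟩
    refine ⟨g, hg, ?_⟩
    have := congrArg Subtype.val hgσ
    simpa using this.symm

/-- Matrix form of LEMMA SPAN (i): the fibre form `c = U * D * Vᵀ` assembled from the canonical images `uᵢ` (columns of
`U`), scalar weights (`D`) and the `vᵢ` (columns of `V`) has `rank c ≤ rank U`; i.e. the tensor rank `r` of `ω` is at most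
the dimension of the span of the canonical images of the first coordinates of a general fibre. -/
theorem rank_fibre_form_le {m n k R : Type*} [Fintype m] [Fintype n] [Fintype k] [DecidableEq n] [DecidableEq k]
    [Field R] (U : Matrix m k R) (D : Matrix k k R) (V : Matrix n k R) :
    (U * D * V.transpose).rank ≤ U.rank :=
  (Matrix.rank_mul_le_left _ _).trans (Matrix.rank_mul_le_left _ _)

/-- The squeeze on the presentation dimension: no pencils (`2 ≤ n`, PROPOSITION NP) and SPAN (`n ≤ d - r`) give
`r + 2 ≤ d` for every product domination. -/
theorem degree_floor {n d r : ℕ} (hnp : 2 ≤ n) (hspan : n ≤ d - r) : r + 2 ≤ d := by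
  omega

/-- Degree `9` on the `T₈` face is impossible: `r` is a positive multiple of `8`, SPAN gives `n ≤ 9 - r ≤ 1`, and pencils
are excluded (`2 ≤ n`, THEOREM GF / PROPOSITION NP). -/
theorem degree_nine_dead {n r : ℕ} (h8 : 8 ∣ r) (hr : 0 < r) (hspan : n ≤ 9 - r) (hnp : 2 ≤ n) : False := by
  omega

/-- Degree `10` on the `T₈` face forces `r = 8` and complete nets `n = 2 = d - r` (so `g = r = 8` by the rigidity clause
of SPAN). -/
theorem degree_ten_nets {n r : ℕ} (h8 : 8 ∣ r) (hr : 0 < r) (hspan : n ≤ 10 - r) (hnp : 2 ≤ n) :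
    r = 8 ∧ n = 2 ∧ n = 10 - r := by
  omega

/-- Type-I carriers (one family of `d` letters): pencils and nets are excluded (`3 ≤ n`) and SPAN with `g ≥ 17` gives
`n ≤ d - 17`; hence at least `20` letters, and at `d = 20` the presentation is spatial (`n = 3`). -/
theorem typeI_letters_floor {n d : ℕ} (h3 : 3 ≤ n) (hspan : n ≤ d - 17) : 20 ≤ d ∧ (d = 20 → n = 3) := by
  omega

end Summit.HodgeConjecture.HodgeConjecture.Theorems.GaloisFloor
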